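import Summits.CriticalPhenomena.Ising3DConformalLimit.Theorems.CanonicalBranchRefutationInfraredExponentZeroSphereMass
import Summits.CriticalPhenomena.Ising3DConformalLimit.Theorems.CanonicalBranchRefutationInfraredExponentZeroHalfBet
import Summits.CriticalPhenomena.Ising3DConformalLimit.Theorems.CanonicalBranchRefutationInfraredExponentZeroDichotomy
import HarnessLib

/-!
# Crux-strategist sketch for `InfraredExponentZero` (stmt-CriticalPhenomena-15521, route
# `CanonicalBranchRefutation`): the kernel-checked part of `STRATEGY-CENSUS.md`

Strategist seat `planner-cstrat-stmt-CriticalPhenomena-15521-s1-0` (2026-08-17). THEOREM-ONLY scratch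
(no `sorry`); nothing here is a registered stub, and nothing restates or weakens the crux. It records,
in Lean, the three census items that can be typed over the tree:

* §D (Decomposition) — the best genuine typed split of the crux, PROVED:
  `InfraredExponentZero ↔ EtaExists ∧ FrequentSphereMassGrowth`, where `EtaExists` is verbatim the
  signature of item stmt-CriticalPhenomena-0635 (`∃ η, HasIsingExponentEta 3 η`, believed TRUE, implied
  by the summit statement — tree `HasPointwiseScalingLimit.exists_isingEta`) and
  `FrequentSphereMassGrowth` is the registered stub `stub_sphereMass_growth` with "eventually" weakened
  to "frequently" (believed FALSE; the tree proves it at exponent `1/2` instead of `1`: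
  `sphereMass_frequently_ge_rpow`, p146335). Ingredients: `η ≥ 0` for any existing exponent (infrared
  ceiling) and `η ≤ 0` from frequent growth (shell count `#∂Λ_n ≤ 54n²`).
* §N (Negation) — the counterexample to the crux, typed: `¬ crux ↔ ¬EtaExists ∨ ∃ ε>0, ∀ᶠ n, M(n) < n^{1-ε}`,
  and, given `EtaExists`, `¬ crux ↔ AnomalousForcesInteraction.EtaPositive` (item stmt-CriticalPhenomena-2600)
  — the `←` half is the landed `not_infraredExponentZero_of_etaPositive` (p146388), the `→` half is new
  (`etaPositive_of_hasIsingExponentEta_pos`). Plus the toy profile `(‖x‖ log ‖x‖)⁻¹`: logarithmic exponent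
  EXACTLY `1` although `‖x‖·F → 0` — why `PerfectScreening.NonSaturation`-shaped statements cannot refute
  the log-sense crux (PROMOTE.md correction, now at kernel level on the model profile).
* §S (Strengthen) — the strengthen-to-induct form `CoulombRateDoubling` (every octave loses at most
  `2^{-(1+ε)}`), typed; `HasIsingEtaBounds 3 0 → crux` is landed (p146389).

References: Duminil-Copin–Panis, CMP 406 (2025) = arXiv:2404.05700, Thms 1.3–1.5, 1.8
[DuminilCopinPanis2025LowerBounds]; Duminil-Copin, ICM 2022, §4.2 [DuminilCopinICM2022];
Kos–Poland–Simmons-Duffin–Vichi 2016 (η = 0.036298(2)) [KosPolandSimmonsDuffinVichi2016].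
-/

noncomputable section

namespace Summit.CriticalPhenomena.Ising3DConformalLimit.Cruxes.InfraredExponentZero.Strategist

open Filter Topology Finset Literature.Probability.LatticeModels
open Summit.CriticalPhenomena.Ising3DConformalLimit.Theses
open Summit.CriticalPhenomena.Ising3DConformalLimit.Theorems

/-! ### §D. The existence/value split (Decomposition heading of the census) -/

/-- `EtaExists`: the anomalous dimension of the critical n.n. Ising model on `ℤ³` EXISTS in the
logarithmic sense — verbatim the signature of item stmt-CriticalPhenomena-0635
(`IsingEuclidUpgrade_r3_etaExists`, also `FilmLadder`/`OctantEntropy.EtaExists`). Believed TRUE; open;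
implied by the summit statement (`HasPointwiseScalingLimit.exists_isingEta`). [cite: DuminilCopinICM2022, §4.2 eq. (4.7)] -/
def EtaExists : Prop := ∃ η : ℝ, HasIsingExponentEta 3 η

/-- `FrequentSphereMassGrowth`: for every `ε > 0` the critical sphere masses
`M(n) = ∑_{y ∈ ∂Λ_n} ⟨σ₀σ_y⟩⁺_{β_c}` satisfy `M(n) ≥ n^{1-ε}` for INFINITELY MANY `n` — the registered stub
`stub_sphereMass_growth` with "eventually" weakened to "frequently". The tree proves exactly this shape at
exponent `1/2 - δ` (`sphereMass_frequently_ge_rpow`, Duminil-Copin–Panis 2025 Thm 1.3 + MMS); the bet is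
the exponent `1`. Believed FALSE (`M(n) ≈ n^{0.9637}`). [cite: DuminilCopinPanis2025LowerBounds, Theorems 1.3 and 1.5] -/
def FrequentSphereMassGrowth : Prop :=
  ∀ ε : ℝ, 0 < ε → ∃ᶠ n : ℕ in atTop, (n : ℝ) ^ (1 - ε) ≤ ∑ y ∈ sphere 3 n, criticalTwoPoint 3 y

/-- Unfolding of `HasIsingExponentEta 3 η` with `3 - 2 + η = 1 + η`. [folklore] -/
theorem tendsto_of_hasIsingExponentEta {η : ℝ} (h : HasIsingExponentEta 3 η) :
    Tendsto (fun x : Site 3 => Real.log (criticalTwoPoint 3 x) / Real.log ‖x‖) cofinite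
      (𝓝 (-(1 + η))) := by
  have h' : HasSpatialDecayExponent (criticalTwoPoint 3) (((3 : ℕ) : ℝ) - 2 + η) := h
  have e : (((3 : ℕ) : ℝ) - 2 + η) = 1 + η := by norm_num
  rw [e] at h'
  exact h'

/-- **`η ≥ 0` for any existing exponent** (infrared ceiling `⟨σ₀σ_x⟩_{β_c} ≤ C‖x‖⁻¹`,
`criticalTwoPoint_bounds_holds`): if `η < 0` the limit would put `⟨σ₀σ_x⟩ > ‖x‖^{-(1+η/2)} ≫ C‖x‖⁻¹`
at some far site. [cite: FrohlichSimonSpencer1976] -/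
theorem eta_nonneg_of_hasIsingExponentEta {η : ℝ} (h : HasIsingExponentEta 3 η) : 0 ≤ η := by
  by_contra hneg
  push Not at hneg
  have hlim := tendsto_of_hasIsingExponentEta h
  obtain ⟨c, C, hc, hbd⟩ := criticalTwoPoint_bounds_holds (d := 3) le_rfl
  have hnorm := Site.tendsto_norm_cofinite_atTop (d := 3)
  have h1 : ∀ᶠ x : Site 3 in cofinite,
      -(1 + η / 2) < Real.log (criticalTwoPoint 3 x) / Real.log ‖x‖ :=
    hlim.eventually (Ioi_mem_nhds (by linarith))
  have h2 : ∀ᶠ x : Site 3 in cofinite, max C 1 < ‖x‖ ^ (-(η / 2)) := by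
    have ht : Tendsto (fun x : Site 3 => ‖x‖ ^ (-(η / 2))) cofinite atTop :=
      (tendsto_rpow_atTop (by linarith)).comp hnorm
    exact ht.eventually_gt_atTop _
  obtain ⟨x, hx1, hx2, hx3⟩ := (h1.and (h2.and (hnorm.eventually_gt_atTop 1))).exists
  have hxpos : 0 < ‖x‖ := by linarith
  have hlogx : 0 < Real.log ‖x‖ := Real.log_pos hx3
  have hx0 : x ≠ 0 := by
    rintro rfl
    rw [norm_zero] at hx3
    linarith
  have hGpos : 0 < criticalTwoPoint 3 x :=
    lt_of_lt_of_le (mul_pos hc (Real.rpow_pos_of_pos hxpos _)) (hbd x hx0).1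
  have hlow : ‖x‖ ^ (-(1 + η / 2)) < criticalTwoPoint 3 x := by
    have h' := (lt_div_iff₀ hlogx).1 hx1
    rw [← Real.log_rpow hxpos] at h'
    exact (Real.log_lt_log_iff (Real.rpow_pos_of_pos hxpos _) hGpos).1 h'
  have hup : criticalTwoPoint 3 x ≤ max C 1 * ‖x‖ ^ (-(1 : ℝ)) := by
    have hb := (hbd x hx0).2
    have e : (-(((3 : ℕ) : ℝ) - 2)) = (-(1 : ℝ)) := by norm_num
    rw [e] at hb
    exact hb.trans (mul_le_mul_of_nonneg_right (le_max_left _ _) (Real.rpow_nonneg hxpos.le _))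
  have hsplit : ‖x‖ ^ (-(1 + η / 2)) = ‖x‖ ^ (-(η / 2)) * ‖x‖ ^ (-(1 : ℝ)) := by
    rw [← Real.rpow_add hxpos]; ring_nf
  have hlt : max C 1 * ‖x‖ ^ (-(1 : ℝ)) < ‖x‖ ^ (-(1 + η / 2)) := by
    rw [hsplit]
    exact mul_lt_mul_of_pos_right hx2 (Real.rpow_pos_of_pos hxpos _)
  linarith

/-- **A positive exponent caps the sphere masses**: `HasIsingExponentEta 3 η` with `η > 0` gives
`M(n) ≤ 54 n^{1-η/2}` for all large `n` (pointwise `⟨σ₀σ_y⟩ ≤ ‖y‖^{-(1+η/2)}` off a finite set, whose sup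
norms are bounded, and `#∂Λ_n ≤ 54n²`). [folklore] -/
theorem eventually_sphereMass_le_of_hasIsingExponentEta_pos {η : ℝ} (hη : 0 < η)
    (h : HasIsingExponentEta 3 η) :
    ∀ᶠ n : ℕ in atTop, ∑ y ∈ sphere 3 n, criticalTwoPoint 3 y ≤ 54 * (n : ℝ) ^ (1 - η / 2) := by
  have hlim := tendsto_of_hasIsingExponentEta h
  obtain ⟨c, C, hc, hbd⟩ := criticalTwoPoint_bounds_holds (d := 3) le_rfl
  have hnorm := Site.tendsto_norm_cofinite_atTop (d := 3)
  have hev : ∀ᶠ x : Site 3 in cofinite, criticalTwoPoint 3 x ≤ ‖x‖ ^ (-(1 + η / 2)) := by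
    have h1 : ∀ᶠ x : Site 3 in cofinite,
        Real.log (criticalTwoPoint 3 x) / Real.log ‖x‖ < -(1 + η / 2) :=
      hlim.eventually (Iio_mem_nhds (by linarith))
    filter_upwards [h1, hnorm.eventually_gt_atTop 1] with x hx hx1
    have hxpos : 0 < ‖x‖ := by linarith
    have hlogx : 0 < Real.log ‖x‖ := Real.log_pos hx1
    have hx0 : x ≠ 0 := by
      rintro rfl
      rw [norm_zero] at hx1
      linarith
    have hGpos : 0 < criticalTwoPoint 3 x :=
      lt_of_lt_of_le (mul_pos hc (Real.rpow_pos_of_pos hxpos _)) (hbd x hx0).1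
    have h2 := (div_lt_iff₀ hlogx).1 hx
    rw [← Real.log_rpow hxpos] at h2
    exact ((Real.log_lt_log_iff hGpos (Real.rpow_pos_of_pos hxpos _)).1 h2).le
  rw [Filter.eventually_cofinite] at hev
  set E : Finset (Site 3) := hev.toFinset with hE
  set N₀ : ℕ := E.sup Site.supNorm with hN₀
  have hgood : ∀ y : Site 3, N₀ < Site.supNorm y → criticalTwoPoint 3 y ≤ ‖y‖ ^ (-(1 + η / 2)) := by
    intro y hy
    by_contra hcon
    have hyE : y ∈ E := hev.mem_toFinset.2 hcon
    have hle : Site.supNorm y ≤ N₀ := Finset.le_sup (f := Site.supNorm) hyE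
    omega
  rw [eventually_atTop]
  refine ⟨N₀ + 1, fun n hn => ?_⟩
  obtain ⟨k, rfl⟩ : ∃ k, n = k + 1 := ⟨n - 1, by omega⟩
  have hnpos : (0 : ℝ) < ((k + 1 : ℕ) : ℝ) := by positivity
  have hterm : ∀ y ∈ sphere 3 (k + 1),
      criticalTwoPoint 3 y ≤ ((k + 1 : ℕ) : ℝ) ^ (-(1 + η / 2)) := by
    intro y hy
    have hyn : Site.supNorm y = k + 1 := mem_sphere.1 hy
    have hy' := hgood y (by omega)
    rwa [Site.norm_eq_supNorm, hyn] at hy'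
  calc ∑ y ∈ sphere 3 (k + 1), criticalTwoPoint 3 y
      ≤ ∑ _y ∈ sphere 3 (k + 1), ((k + 1 : ℕ) : ℝ) ^ (-(1 + η / 2)) := Finset.sum_le_sum hterm
    _ = (#(sphere 3 (k + 1)) : ℝ) * ((k + 1 : ℕ) : ℝ) ^ (-(1 + η / 2)) := by
        rw [Finset.sum_const, nsmul_eq_mul]
    _ ≤ 54 * ((k : ℝ) + 1) ^ 2 * ((k + 1 : ℕ) : ℝ) ^ (-(1 + η / 2)) :=
        mul_le_mul_of_nonneg_right (card_sphere_three_le k) (Real.rpow_nonneg hnpos.le _)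
    _ = 54 * ((k + 1 : ℕ) : ℝ) ^ (1 - η / 2) := by
        have e : ((k : ℝ) + 1) = ((k + 1 : ℕ) : ℝ) := by push_cast; ring
        rw [e, show (1 - η / 2 : ℝ) = 2 + -(1 + η / 2) by ring, Real.rpow_add hnpos, Real.rpow_two]
        ring

/-- **`η ≤ 0` from frequent growth**: if the exponent `η` exists and the sphere masses reach `n^{1-ε}`
infinitely often for every `ε > 0`, then `η ≤ 0` (else `M(n) ≤ 54 n^{1-η/2}` eventually beats
`M(n) ≥ n^{1-η/4}` frequently). [folklore] -/
theorem eta_nonpos_of_frequentSphereMassGrowth {η : ℝ} (h : HasIsingExponentEta 3 η)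
    (hg : FrequentSphereMassGrowth) : η ≤ 0 := by
  by_contra hpos
  push Not at hpos
  have hup := eventually_sphereMass_le_of_hasIsingExponentEta_pos hpos h
  have hev2 : ∀ᶠ n : ℕ in atTop, 54 * (n : ℝ) ^ (1 - η / 2) < (n : ℝ) ^ (1 - η / 4) := by
    have ht : Tendsto (fun n : ℕ => (n : ℝ) ^ (η / 4)) atTop atTop :=
      (tendsto_rpow_atTop (by linarith)).comp tendsto_natCast_atTop_atTop
    filter_upwards [ht.eventually_gt_atTop 54, eventually_ge_atTop 1] with n hn hn1
    have hn0 : (0 : ℝ) < n := by exact_mod_cast hn1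
    calc 54 * (n : ℝ) ^ (1 - η / 2) < (n : ℝ) ^ (η / 4) * (n : ℝ) ^ (1 - η / 2) :=
          mul_lt_mul_of_pos_right hn (Real.rpow_pos_of_pos hn0 _)
      _ = (n : ℝ) ^ (1 - η / 4) := by rw [← Real.rpow_add hn0]; ring_nf
  have hfr := hg (η / 4) (by linarith)
  obtain ⟨n, hn1, hn2, hn3⟩ := (hfr.and_eventually (hup.and hev2)).exists
  linarith

/-- **Split, forward direction (the glue `Sub₁ → Sub₂ → crux`, PROVED):** existence of `η` plus frequent
sphere-mass growth at exponent `1` give `η = 0`, i.e. the crux `InfraredExponentZero`. [folklore] -/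
theorem infraredExponentZero_of_etaExists_of_frequentSphereMassGrowth
    (hex : EtaExists) (hg : FrequentSphereMassGrowth) :
    CanonicalBranchRefutation.InfraredExponentZero := by
  obtain ⟨η, hη⟩ := hex
  have h0 : η = 0 :=
    le_antisymm (eta_nonpos_of_frequentSphereMassGrowth hη hg) (eta_nonneg_of_hasIsingExponentEta hη)
  subst h0
  exact hη

/-- The crux gives existence (with `η = 0`). [folklore] -/
theorem etaExists_of_infraredExponentZero (h : CanonicalBranchRefutation.InfraredExponentZero) :
    EtaExists := ⟨0, h⟩

/-- The crux gives frequent growth (it even gives eventual growth: landed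
`sphereMass_growth_of_infraredExponentZero`, p146388). [folklore] -/
theorem frequentSphereMassGrowth_of_infraredExponentZero
    (h : CanonicalBranchRefutation.InfraredExponentZero) : FrequentSphereMassGrowth :=
  fun ε hε => (sphereMass_growth_of_infraredExponentZero h ε hε).frequently

/-- **The split is exact**: `InfraredExponentZero ↔ EtaExists ∧ FrequentSphereMassGrowth`.
Which piece remains the whole crux: `FrequentSphereMassGrowth` (the tree has it at exponent `1/2`,
`sphereMass_frequently_ge_rpow`; the gap `[1/2, 1]` is the open content); `EtaExists` is item
stmt-CriticalPhenomena-0635 (open, believed true, implied by the summit). [folklore] -/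
theorem infraredExponentZero_iff_etaExists_and_frequentSphereMassGrowth :
    CanonicalBranchRefutation.InfraredExponentZero ↔ EtaExists ∧ FrequentSphereMassGrowth :=
  ⟨fun h => ⟨etaExists_of_infraredExponentZero h, frequentSphereMassGrowth_of_infraredExponentZero h⟩,
    fun h => infraredExponentZero_of_etaExists_of_frequentSphereMassGrowth h.1 h.2⟩

/-- For the record: the frequent-growth piece IS a theorem at exponent `1/2` (landed p146335).
[cite: DuminilCopinPanis2025LowerBounds, Theorem 1.3] -/
example : ∀ δ : ℝ, 0 < δ → ∃ᶠ m : ℕ in atTop,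
    (m : ℝ) ^ (1 / 2 - δ) ≤ ∑ y ∈ sphere 3 m, criticalTwoPoint 3 y :=
  sphereMass_frequently_ge_rpow

/-! ### §N. The negation, typed (Negation heading of the census) -/

/-- **The counterexample to the crux, typed**: `¬ InfraredExponentZero` iff EITHER the exponent `η` does not
exist OR the sphere masses stay below some power `n^{1-ε}` for ALL large `n`. [folklore] -/
theorem not_infraredExponentZero_iff :
    ¬ CanonicalBranchRefutation.InfraredExponentZero ↔
      (¬ EtaExists ∨ ∃ ε : ℝ, 0 < ε ∧ ∀ᶠ n : ℕ in atTop,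
        ∑ y ∈ sphere 3 n, criticalTwoPoint 3 y < (n : ℝ) ^ (1 - ε)) := by
  rw [infraredExponentZero_iff_etaExists_and_frequentSphereMassGrowth, not_and_or]
  apply or_congr_right
  simp only [FrequentSphereMassGrowth, not_forall, not_frequently, not_le, exists_prop]

/-- **A positive exponent is a power gain everywhere**: `HasIsingExponentEta 3 η` with `η > 0` implies
`AnomalousForcesInteraction.EtaPositive` (item stmt-CriticalPhenomena-2600) with `κ = η/2` — the finite
exceptional set of the limit is absorbed into the constant via the infrared ceiling. [folklore] -/
theorem etaPositive_of_hasIsingExponentEta_pos {η : ℝ} (hη : 0 < η) (h : HasIsingExponentEta 3 η) :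
    AnomalousForcesInteraction.EtaPositive := by
  have hlim := tendsto_of_hasIsingExponentEta h
  obtain ⟨c, C, hc, hbd⟩ := criticalTwoPoint_bounds_holds (d := 3) le_rfl
  have hnorm := Site.tendsto_norm_cofinite_atTop (d := 3)
  have hev : ∀ᶠ x : Site 3 in cofinite, criticalTwoPoint 3 x ≤ ‖x‖ ^ (-(1 + η / 2)) := by
    have h1 : ∀ᶠ x : Site 3 in cofinite,
        Real.log (criticalTwoPoint 3 x) / Real.log ‖x‖ < -(1 + η / 2) :=
      hlim.eventually (Iio_mem_nhds (by linarith))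
    filter_upwards [h1, hnorm.eventually_gt_atTop 1] with x hx hx1
    have hxpos : 0 < ‖x‖ := by linarith
    have hlogx : 0 < Real.log ‖x‖ := Real.log_pos hx1
    have hx0 : x ≠ 0 := by
      rintro rfl
      rw [norm_zero] at hx1
      linarith
    have hGpos : 0 < criticalTwoPoint 3 x :=
      lt_of_lt_of_le (mul_pos hc (Real.rpow_pos_of_pos hxpos _)) (hbd x hx0).1
    have h2 := (div_lt_iff₀ hlogx).1 hx
    rw [← Real.log_rpow hxpos] at h2
    exact ((Real.log_lt_log_iff hGpos (Real.rpow_pos_of_pos hxpos _)).1 h2).le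
  rw [Filter.eventually_cofinite] at hev
  set E : Finset (Site 3) := hev.toFinset with hE
  set N₀ : ℕ := E.sup Site.supNorm with hN₀
  have hgood : ∀ y : Site 3, N₀ < Site.supNorm y → criticalTwoPoint 3 y ≤ ‖y‖ ^ (-(1 + η / 2)) := by
    intro y hy
    by_contra hcon
    have hyE : y ∈ E := hev.mem_toFinset.2 hcon
    have hle : Site.supNorm y ≤ N₀ := Finset.le_sup (f := Site.supNorm) hyE
    omega
  -- the constant: `K := max C 0 * (N₀+1)^{1+η/2}` dominates on the exceptional box, `1` outside it
  set a : ℝ := 1 + η / 2 with ha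
  have hapos : 0 < a := by rw [ha]; linarith
  set K : ℝ := max C 0 * ((N₀ : ℝ) + 1) ^ a with hK
  refine ⟨η / 2, max 1 K, by linarith, fun x hx0 => ?_⟩
  have hx1 : 1 ≤ Site.supNorm x :=
    Nat.one_le_iff_ne_zero.2 fun h0 => hx0 (Site.supNorm_eq_zero_iff.1 h0)
  have hnx : ‖x‖ = (Site.supNorm x : ℝ) := Site.norm_eq_supNorm x
  have hxpos : (0 : ℝ) < ‖x‖ := by rw [hnx]; exact_mod_cast hx1
  by_cases hfar : N₀ < Site.supNorm x
  · calc criticalTwoPoint 3 x ≤ ‖x‖ ^ (-(1 + η / 2)) := hgood x hfar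
      _ = 1 * ‖x‖ ^ (-(1 + η / 2)) := (one_mul _).symm
      _ ≤ max 1 K * ‖x‖ ^ (-(1 + η / 2)) :=
          mul_le_mul_of_nonneg_right (le_max_left _ _) (Real.rpow_nonneg hxpos.le _)
  · push Not at hfar
    have hxle : ‖x‖ ≤ (N₀ : ℝ) + 1 := by
      rw [hnx]; exact_mod_cast (Nat.le_succ_of_le hfar)
    -- `G x ≤ C ‖x‖⁻¹ ≤ max C 0`
    have hG : criticalTwoPoint 3 x ≤ max C 0 := by
      have hb := (hbd x hx0).2
      have e : (-(((3 : ℕ) : ℝ) - 2)) = (-(1 : ℝ)) := by norm_num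
      rw [e] at hb
      have hx1' : (1 : ℝ) ≤ ‖x‖ := by rw [hnx]; exact_mod_cast hx1
      have hinv : ‖x‖ ^ (-(1 : ℝ)) ≤ 1 := by
        rw [Real.rpow_neg hxpos.le, Real.rpow_one]
        exact inv_le_one_of_one_le₀ hx1'
      calc criticalTwoPoint 3 x ≤ C * ‖x‖ ^ (-(1 : ℝ)) := hb
        _ ≤ max C 0 * ‖x‖ ^ (-(1 : ℝ)) :=
            mul_le_mul_of_nonneg_right (le_max_left _ _) (Real.rpow_nonneg hxpos.le _)
        _ ≤ max C 0 * 1 := mul_le_mul_of_nonneg_left hinv (le_max_right _ _)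
        _ = max C 0 := mul_one _
    -- `1 ≤ (N₀+1)^a ‖x‖^{-a}` on the box
    have hN : (0 : ℝ) < (N₀ : ℝ) + 1 := by positivity
    have hone : (1 : ℝ) ≤ ((N₀ : ℝ) + 1) ^ a * ‖x‖ ^ (-a) := by
      have hpow : ‖x‖ ^ a ≤ ((N₀ : ℝ) + 1) ^ a := Real.rpow_le_rpow hxpos.le hxle hapos.le
      have hxa : 0 < ‖x‖ ^ a := Real.rpow_pos_of_pos hxpos _
      rw [Real.rpow_neg hxpos.le, ← div_eq_mul_inv, le_div_iff₀ hxa, one_mul]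
      exact hpow
    have hη2 : (-(1 + η / 2) : ℝ) = -a := by rw [ha]
    rw [hη2]
    calc criticalTwoPoint 3 x ≤ max C 0 := hG
      _ = max C 0 * 1 := (mul_one _).symm
      _ ≤ max C 0 * (((N₀ : ℝ) + 1) ^ a * ‖x‖ ^ (-a)) :=
          mul_le_mul_of_nonneg_left hone (le_max_right _ _)
      _ = K * ‖x‖ ^ (-a) := by rw [hK]; ring
      _ ≤ max 1 K * ‖x‖ ^ (-a) :=
          mul_le_mul_of_nonneg_right (le_max_right _ _) (Real.rpow_nonneg hxpos.le _)

/-- **Given existence, the refutation of the crux IS `EtaPositive`** (item stmt-CriticalPhenomena-2600,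
declared crux-sized by two lead seats, `Cruxes/EtaPositive/PROMOTE.md`): `EtaExists → ¬ crux → EtaPositive`.
[folklore] -/
theorem etaPositive_of_etaExists_of_not_infraredExponentZero (hex : EtaExists)
    (hn : ¬ CanonicalBranchRefutation.InfraredExponentZero) :
    AnomalousForcesInteraction.EtaPositive := by
  obtain ⟨η, hη⟩ := hex
  rcases (eta_nonneg_of_hasIsingExponentEta hη).eq_or_lt with h0 | hpos
  · subst h0
    exact absurd hη hn
  · exact etaPositive_of_hasIsingExponentEta_pos hpos hη

/-- **Under `EtaExists`: `EtaPositive ↔ ¬ InfraredExponentZero`** (`→` landed as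
`not_infraredExponentZero_of_etaPositive`, p146388). [folklore] -/
theorem etaPositive_iff_not_infraredExponentZero (hex : EtaExists) :
    AnomalousForcesInteraction.EtaPositive ↔ ¬ CanonicalBranchRefutation.InfraredExponentZero :=
  ⟨not_infraredExponentZero_of_etaPositive, etaPositive_of_etaExists_of_not_infraredExponentZero hex⟩

/-- **Hence the full negation web**: `¬ crux ↔ ¬ EtaExists ∨ EtaPositive`. [folklore] -/
theorem not_infraredExponentZero_iff_not_etaExists_or_etaPositive :
    ¬ CanonicalBranchRefutation.InfraredExponentZero ↔
      (¬ EtaExists ∨ AnomalousForcesInteraction.EtaPositive) := by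
  constructor
  · intro hn
    by_cases hex : EtaExists
    · exact Or.inr (etaPositive_of_etaExists_of_not_infraredExponentZero hex hn)
    · exact Or.inl hex
  · rintro (hne | hpos)
    · exact fun h => hne (etaExists_of_infraredExponentZero h)
    · exact not_infraredExponentZero_of_etaPositive hpos

/-! #### §N, toy check: `NonSaturation`-shaped asymptotics do not refute the log-sense crux

The model profile `F(x) = (‖x‖ log ‖x‖)⁻¹` on `ℤ³` has logarithmic decay exponent EXACTLY `1` (the value
the crux asserts for `⟨σ₀σ_x⟩_{β_c}`) and yet `‖x‖ F(x) → 0`, i.e. it is NOT bounded below by `c‖x‖⁻¹`: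
a refutation of `InfraredExponentZero` needs a POWER gain, not the `o(‖x‖⁻¹)` that
`PerfectScreening.NonSaturation ∧ ScreeningUpgrade` deliver (PROMOTE.md, "Correction for the planner"). -/

/-- `(‖x‖ log ‖x‖)⁻¹` has spatial decay exponent `1` on `ℤ³`. [folklore] -/
theorem logCorrected_hasSpatialDecayExponent_one :
    HasSpatialDecayExponent (fun x : Site 3 => (‖x‖ * Real.log ‖x‖)⁻¹) 1 := by
  unfold HasSpatialDecayExponent
  have hnorm := Site.tendsto_norm_cofinite_atTop (d := 3)
  have hlog : Tendsto (fun x : Site 3 => Real.log ‖x‖) cofinite atTop :=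
    Real.tendsto_log_atTop.comp hnorm
  have h1 : Tendsto (fun u : ℝ => Real.log u / u) atTop (𝓝 0) :=
    Real.isLittleO_log_id_atTop.tendsto_div_nhds_zero
  have h2 : Tendsto (fun x : Site 3 => Real.log (Real.log ‖x‖) / Real.log ‖x‖) cofinite (𝓝 0) :=
    h1.comp hlog
  have h3 : Tendsto (fun x : Site 3 => -1 - Real.log (Real.log ‖x‖) / Real.log ‖x‖) cofinite
      (𝓝 (-1 - 0)) := tendsto_const_nhds.sub h2
  rw [sub_zero] at h3
  refine h3.congr' ?_
  filter_upwards [hnorm.eventually_gt_atTop (Real.exp 1)] with x hx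
  have hxpos : 0 < ‖x‖ := lt_trans (Real.exp_pos 1) hx
  have hlogx : 1 < Real.log ‖x‖ := by rwa [Real.lt_log_iff_exp_lt hxpos]
  have hlogpos : 0 < Real.log ‖x‖ := by linarith
  rw [Real.log_inv, Real.log_mul hxpos.ne' hlogpos.ne']
  field_simp
  ring

/-- … and `‖x‖ · (‖x‖ log ‖x‖)⁻¹ → 0`: the profile is NOT two-sided Coulomb (`NonSaturation`-shaped).
[folklore] -/
theorem logCorrected_norm_mul_tendsto_zero :
    Tendsto (fun x : Site 3 => ‖x‖ * (‖x‖ * Real.log ‖x‖)⁻¹) cofinite (𝓝 0) := by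
  have hnorm := Site.tendsto_norm_cofinite_atTop (d := 3)
  have hlog : Tendsto (fun x : Site 3 => Real.log ‖x‖) cofinite atTop :=
    Real.tendsto_log_atTop.comp hnorm
  refine (hlog.inv_tendsto_atTop).congr' ?_
  filter_upwards [hnorm.eventually_gt_atTop 1] with x hx
  have hxpos : 0 < ‖x‖ := by linarith
  simp only [Pi.inv_apply]
  rw [mul_inv, ← mul_assoc, mul_inv_cancel₀ hxpos.ne', one_mul]

/-! ### §S. Strengthen-to-induct, typed (Strengthen heading of the census) -/

/-- **S⁺₁ (two-sided Coulomb)** `HasIsingEtaBounds 3 0` ⇒ crux: LANDED (p146389). Believed false even more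
robustly than the crux (`PerfectScreening.NonSaturation`, item stmt-CriticalPhenomena-1342, is its negation
along the axis and is believed TRUE). [cite: FriedliVelenik2017, §3.10.11] -/
example : HasIsingEtaBounds 3 0 → CanonicalBranchRefutation.InfraredExponentZero :=
  infraredExponentZero_of_hasIsingEtaBounds_zero

/-- **S⁺₂ (Coulomb-rate doubling, the scale-inductive form of the bet)**: for every `ε > 0`, eventually
in `n`, `⟨σ₀σ_{2n e₁}⟩_{β_c} ≥ 2^{-(1+ε)} ⟨σ₀σ_{n e₁}⟩_{β_c}` — each octave loses at most the Coulomb factor.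
With MMS monotonicity along the axis (`criticalTwoPoint_axis_antitone`) and the dyadic lemma
`HasDecayExponent.of_dyadic_of_antitone` it yields the axis exponent `1`, hence the crux; it is STRICTLY
stronger in kind (an octave-ratio regularity, cf. the OPEN sibling cruxes `TwoPointDoubling`
(`∃ κ > 0, κ⟨σ₀σ_{ne₁}⟩ ≤ ⟨σ₀σ_{2ne₁}⟩`, four routes) and `TwoPointRegularVariation`), and the crux does not
imply it. Recorded as a signature only: no octave-to-octave LOWER bound at rate better than `G²` (GKS) is
known. [cite: DuminilCopin2019, §4.3] -/
def CoulombRateDoubling : Prop :=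
  ∀ ε : ℝ, 0 < ε → ∀ᶠ n : ℕ in atTop,
    (2 : ℝ) ^ (-(1 + ε)) * criticalTwoPoint 3 (Pi.single 0 (n : ℤ)) ≤
      criticalTwoPoint 3 (Pi.single 0 (2 * (n : ℤ)))

/-- **S⁺₃ (Green-function domination from below)**: `⟨σ₀σ_x⟩_{β_c} ≥ c‖x‖⁻¹` for all `x ≠ 0` — the lower
half of S⁺₁ alone already gives the crux (the upper half is the tree's infrared ceiling); it is
`¬ PerfectScreening.NonSaturation` in all directions (landed `not_nonSaturation_iff_hasIsingEtaBounds_zero`).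
[cite: DuminilCopin2019, Thm. 4.8] -/
def CoulombFloor : Prop :=
  ∃ c : ℝ, 0 < c ∧ ∀ x : Site 3, x ≠ 0 → c * ‖x‖ ^ (-(1 : ℝ)) ≤ criticalTwoPoint 3 x

/-- `CoulombFloor → crux` (floor + tree ceiling = `HasIsingEtaBounds 3 0`). [folklore] -/
theorem infraredExponentZero_of_coulombFloor (h : CoulombFloor) :
    CanonicalBranchRefutation.InfraredExponentZero := by
  obtain ⟨c, hc, hlow⟩ := h
  obtain ⟨c₀, C₀, hc₀, hbd⟩ := criticalTwoPoint_bounds_holds (d := 3) le_rfl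
  refine infraredExponentZero_of_hasIsingEtaBounds_zero ⟨c, C₀, hc, fun x hx => ?_⟩
  have e : (-(((3 : ℕ) : ℝ) - 2 + 0)) = (-(1 : ℝ)) := by norm_num
  rw [e]
  have hb := (hbd x hx).2
  have e' : (-(((3 : ℕ) : ℝ) - 2)) = (-(1 : ℝ)) := by norm_num
  rw [e'] at hb
  exact ⟨hlow x hx, hb⟩

end Summit.CriticalPhenomena.Ising3DConformalLimit.Cruxes.InfraredExponentZero.Strategist
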